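import Summits.AtomisticToContinuum.FouriersLaw.Theses.BondHeatUncertainty

/-!
# `LightConeBondHeat` from `SubdiffusiveBondHeat` (route BondHeatUncertainty, item stmt-AtomisticToContinuum-9123)

The support item `LightConeBondHeat` (S_lc) is the light-cone-window (`1 ≤ t ≤ a·N`) case of the crux
`SubdiffusiveBondHeat` (S) (Thouless window `1 ≤ t ≤ c·N²`), for the same equilibrium bond-heat variance
functional `V_N(b,t) = 2∫₀ᵗ (t−s) C_N(b,s) ds` of the pinned anharmonic chain.  Since `a·N ≤ c·N²` as soon as
`a = c` and `N ≥ 1`, (S) implies (S_lc) by restricting the window.  This file records that reduction, so that the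
item closes by one term once the crux lands.
-/

namespace Summit.AtomisticToContinuum.FouriersLaw.Theorems

open Summit.AtomisticToContinuum.FouriersLaw.Theses.BondHeatUncertainty

/-- **(S) ⇒ (S_lc).**  The Thouless-window law `SubdiffusiveBondHeat` implies the light-cone-window law
`LightConeBondHeat`: take the same constant `A`, the slope `a := c`, the same bond, and `N₀ := max N₀ 1`; on the
window `1 ≤ t ≤ c·N` one has `t ≤ c·N ≤ c·N²` because `1 ≤ N`. -/
theorem lightConeBondHeat_of_subdiffusiveBondHeat (hS : SubdiffusiveBondHeat) : LightConeBondHeat := by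
  intro ω₂ lam β γ hω hl hβ hγ T hT
  obtain ⟨A, c, hc, N₀, hN₀⟩ := hS ω₂ lam β γ hω hl hβ hγ T hT
  refine ⟨A, c, hc, max N₀ 1, fun N hN => ?_⟩
  obtain ⟨b, hb, hV⟩ := hN₀ N (le_trans (le_max_left _ _) hN)
  refine ⟨b, hb, fun t ht htN => hV t ht ?_⟩
  have hN1 : (1 : ℝ) ≤ (N : ℝ) := by exact_mod_cast le_trans (le_max_right _ _) hN
  have hcN : c * (N : ℝ) ≤ c * (N : ℝ) ^ 2 := by
    have : (N : ℝ) ≤ (N : ℝ) ^ 2 := by nlinarith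
    exact mul_le_mul_of_nonneg_left this hc.le
  exact le_trans htN hcN

end Summit.AtomisticToContinuum.FouriersLaw.Theorems
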